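import Literature.Analysis.FluidPDE.PassiveVectorTensorStreamStability
import HarnessLib

/-!
# Series of stream potentials: the weak divergence identity for a normally convergent sum of
# levels, and the stream-form energy stability with LEVELWISE hypotheses (the infinite tail)

Analysis/FluidPDE proof-support file (everything proved; no definitions, no named facts). Sequel of
`PassiveVectorTensorStreamStability` (stream-potential perturbation of the carrier of Frisch's
anisotropic-eddy-viscosity passive-vector equation, `A = 0`).

There the carrier perturbation is ONE antisymmetric potential: `b − b' = ∇·ψ` in distributions,
`|ψᵢₐ| ≤ Λ`. In the fractal / lattice cascades the perturbation is an INFINITE TAIL of levels,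
`b − b' = Σ_{m>j} c_m`, each level being a divergence `c_m = ∇·ψ_m` of an explicit antisymmetric
potential with `|ψ_m| ≤ Λ_m`, `‖c_m‖ ≤ B_m`, and `Σ B_m`, `Σ Λ_m < ∞` (normal convergence). This file
proves that the weak divergence identity passes to such sums (§1: on `𝕋ᵈ` at one time — the series
may be indexed by any countable type; the only analysis is the interchange of `Σ_m` with the integral
against a smooth test function, i.e. continuity of differentiation in `𝒟'`), records the bound
`|Σ_m ψ_m| ≤ Σ_m Λ_m`, the antisymmetry and the a.e.-strong measurability of the summed potential, the
tail form `Σ' − Σ_{m<j} = Σ'_m (·)(m+j)` (§2), the time-dependent lift producing VERBATIM the four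
stream hypotheses `hanti / hψΛ / hψm / hdivψ` of `ae_integral_norm_sq_sub_le_of_stream` (§3), and
the three stability statements with levelwise hypotheses, `Λ := Σ'_m Λ_m` (§4), plus the elementary
shape of the smallness coefficient `2√(d²Λ²/(4lo²)) + d²Λ²/(4lo²) = 2η + η²`, `η = dΛ/(2lo)` (§5).

## Main results

* `Torus.integral_tsum_apply_mul_eq_neg_integral_tsum_potential`: levels `c i = ∇·ψ i` weakly
  against smooth scalar tests, `‖c i‖ ≤ B i`, `|ψ i| ≤ Λ i`, `Σ B`, `Σ Λ < ∞` ⇒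
  `∫ (Σ' i, c i x)_a φ = −∫ Σ_j (Σ' i, ψ i x j a) ∂_j φ`.
* `Torus.integral_tsum_sub_sum_apply_mul_eq_neg_integral_tsum_potential`: the same for the tail
  `Σ'_m c m − Σ_{m<j} c m` with the tail potential `Σ'_m ψ (m+j)`.
* `Torus.stream_of_levels`, `Torus.stream_of_levels_tail`: time-dependent lift — the stream
  hypotheses of `PassiveVectorTensorStreamStability` for `b − b'` from levelwise data.
* `Torus.IsWeakTensorPassiveVectorOn.ae_integral_norm_sq_sub_le_of_levels`,
  `…_of_levels_datum`, `…ae_integral_norm_sq_le_add_of_levels`: the energy-class stability with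
  `Λ = Σ' i, Λ i`.
* `Torus.stream_coeff_eq`, `Torus.stream_coeff_le_of_ratio_le`: `2√(D²Λ²/(4lo²)) + D²Λ²/(4lo²)
  = 2η + η² ≤ 3η` for `η = DΛ/(2lo) ≤ 1`.

## Mathlib / tree search

Mathlib: `integral_tsum_of_summable_integral_norm`, `Summable.of_norm_bounded`,
`tsum_of_norm_bounded`, `aestronglyMeasurable_of_tendsto_ae`, `Summable.sum_add_tsum_nat_add`,
`Summable.tsum_finsetSum`, `ContinuousLinearMap.map_tsum`. Tree: `PassiveVectorTensorStreamStability`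
(the one-potential estimates this file feeds), `FlatTorus` (`Continuous.integrable_unitAddTorus`).
Continuity of differentiation on `𝒟'` and completeness under pointwise limits: Hörmander, ALPDO I,
§3.1 (Definition 3.1.1 and the remark following it), Thm. 2.1.8.

## References

* L. Hörmander, *The Analysis of Linear Partial Differential Operators I*, Springer 1983, §2.1
  Thm. 2.1.8, §3.1 Def. 3.1.1. [`HormanderALPDO1`]
* R. J. DiPerna, P.-L. Lions, Invent. Math. 98 (1989), §II.1 Thm. II.1. [`DiPernaLions1989`]
* J. C. Robinson, J. L. Rodrigo, W. Sadowski, *The three-dimensional Navier–Stokes equations*,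
  CUP 2016, §4.2 (4.20). [`RobinsonRodrigoSadowski2016`]
-/

noncomputable section

open MeasureTheory Set Filter Function TopologicalSpace
open scoped ENNReal NNReal InnerProductSpace Topology

namespace Literature.Analysis.FluidPDE

namespace Torus

variable {d : Type*} [Fintype d] [DecidableEq d]

/-! ## §1 Series of weak stream identities at one time -/

section Levels

variable {ι : Type*} {c : ι → UnitAddTorus d → EuclideanSpace ℝ d} {ψ : ι → UnitAddTorus d → d → d → ℝ}
  {B Λ : ι → ℝ}

omit [DecidableEq d] in
/-- Normally convergent levels are pointwise summable. [cite: HormanderALPDO1, §2.1 Thm. 2.1.8] -/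
theorem summable_levels (hB : Summable B) (hcB : ∀ i x, ‖c i x‖ ≤ B i) (x : UnitAddTorus d) :
    Summable fun i => c i x :=
  Summable.of_norm_bounded hB fun i => hcB i x

omit [DecidableEq d] in
/-- Components of the summed level: `(Σ' i, c i x)_a = Σ' i, (c i x)_a`. [cite: HormanderALPDO1, §2.1 Thm. 2.1.8] -/
theorem tsum_levels_apply (hB : Summable B) (hcB : ∀ i x, ‖c i x‖ ≤ B i) (x : UnitAddTorus d) (a : d) :
    (∑' i, c i x) a = ∑' i, c i x a := by
  simpa using (EuclideanSpace.proj a : EuclideanSpace ℝ d →L[ℝ] ℝ).map_tsum (summable_levels hB hcB x)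

omit [DecidableEq d] in
/-- `‖Σ' i, c i x‖ ≤ Σ' i, B i`. [cite: HormanderALPDO1, §2.1 Thm. 2.1.8] -/
theorem norm_tsum_levels_le (hB : Summable B) (hcB : ∀ i x, ‖c i x‖ ≤ B i) (x : UnitAddTorus d) :
    ‖∑' i, c i x‖ ≤ ∑' i, B i :=
  tsum_of_norm_bounded hB.hasSum fun i => hcB i x

omit [DecidableEq d] in
/-- The summed level is a.e.-strongly measurable (pointwise limit of finite sums).
[cite: HormanderALPDO1, §2.1 Thm. 2.1.8] -/
theorem aestronglyMeasurable_tsum_levels [Countable ι] (hB : Summable B) (hcB : ∀ i x, ‖c i x‖ ≤ B i)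
    (hcm : ∀ i, AEStronglyMeasurable (c i) volume) :
    AEStronglyMeasurable (fun x => ∑' i, c i x) volume :=
  aestronglyMeasurable_of_tendsto_ae (atTop : Filter (Finset ι)) (f := fun s x => ∑ i ∈ s, c i x)
    (fun s => Finset.aestronglyMeasurable_fun_sum s fun i _ => hcm i)
    (ae_of_all _ fun x => (summable_levels hB hcB x).hasSum)

omit [Fintype d] [DecidableEq d] in
/-- Levelwise potentials with summable bounds are pointwise summable. [cite: HormanderALPDO1, §2.1 Thm. 2.1.8] -/
theorem summable_potential (hΛ : Summable Λ) (hψΛ : ∀ i x j a, |ψ i x j a| ≤ Λ i)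
    (x : UnitAddTorus d) (j a : d) : Summable fun i => ψ i x j a :=
  Summable.of_norm_bounded hΛ fun i => by simpa only [Real.norm_eq_abs] using hψΛ i x j a

omit [Fintype d] [DecidableEq d] in
/-- The summed potential of antisymmetric potentials is antisymmetric (no summability needed).
[cite: HormanderALPDO1, §3.1 Def. 3.1.1] -/
theorem tsum_potential_antisymm (hanti : ∀ i x j a, ψ i x j a = -ψ i x a j) (x : UnitAddTorus d) (j a : d) :
    (∑' i, ψ i x j a) = -∑' i, ψ i x a j := by
  rw [← tsum_neg]
  exact tsum_congr fun i => hanti i x j a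

omit [Fintype d] [DecidableEq d] in
/-- `|Σ' i, ψ i x j a| ≤ Σ' i, Λ i`. [cite: HormanderALPDO1, §2.1 Thm. 2.1.8] -/
theorem abs_tsum_potential_le (hΛ : Summable Λ) (hψΛ : ∀ i x j a, |ψ i x j a| ≤ Λ i)
    (x : UnitAddTorus d) (j a : d) : |∑' i, ψ i x j a| ≤ ∑' i, Λ i := by
  have h := tsum_of_norm_bounded (f := fun i => ψ i x j a) hΛ.hasSum fun i => by
    simpa only [Real.norm_eq_abs] using hψΛ i x j a
  simpa only [Real.norm_eq_abs] using h

omit [DecidableEq d] in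
/-- The summed potential is a.e.-strongly measurable. [cite: HormanderALPDO1, §2.1 Thm. 2.1.8] -/
theorem aestronglyMeasurable_tsum_potential [Countable ι] (hΛ : Summable Λ) (hψΛ : ∀ i x j a, |ψ i x j a| ≤ Λ i)
    (hψm : ∀ i j a, AEStronglyMeasurable (fun x => ψ i x j a) volume) (j a : d) :
    AEStronglyMeasurable (fun x => ∑' i, ψ i x j a) volume :=
  aestronglyMeasurable_of_tendsto_ae (atTop : Filter (Finset ι)) (f := fun s x => ∑ i ∈ s, ψ i x j a)
    (fun s => Finset.aestronglyMeasurable_fun_sum s fun i _ => hψm i j a)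
    (ae_of_all _ fun x => (summable_potential hΛ hψΛ x j a).hasSum)

omit [DecidableEq d] in
/-- A smooth function on the torus is bounded. [folklore] -/
private theorem exists_forall_abs_le_of_isSmooth {φ : UnitAddTorus d → ℝ} (hφ : FunctionSpaces.Torus.IsSmooth φ) :
    ∃ C, 0 ≤ C ∧ ∀ x, |φ x| ≤ C := by
  obtain ⟨C, hC⟩ := isCompact_univ.exists_bound_of_continuousOn (hφ.continuous.continuousOn (s := univ))
  exact ⟨max C 0, le_max_right _ _, fun x => (Real.norm_eq_abs _ ▸ hC x (mem_univ x)).trans (le_max_left _ _)⟩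

/-- **Series of weak stream identities.** If every level `c i : 𝕋ᵈ → ℝᵈ` is the distributional
divergence of a potential `ψ i` against smooth scalar tests — `∫ (c i)_a φ = −∫ Σ_j (ψ i)_{ja} ∂_j φ`
— with `‖c i‖ ≤ B i`, `|(ψ i)_{ja}| ≤ Λ i` and `Σ B`, `Σ Λ < ∞`, then the (pointwise, absolutely
convergent) sum `Σ' i, c i` is the divergence of the summed potential `Σ' i, ψ i` in the same weak
sense. (Differentiation is continuous on `𝒟'`; here both series converge normally, so the only step
is the interchange of `Σ' i` with the integral against the bounded test data.)
[cite: HormanderALPDO1, §3.1 Def. 3.1.1 (continuity of u ↦ ∂ₖu) and §2.1 Thm. 2.1.8] -/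
theorem integral_tsum_apply_mul_eq_neg_integral_tsum_potential [Countable ι]
    (hB : Summable B) (hΛ : Summable Λ) (hcB : ∀ i x, ‖c i x‖ ≤ B i)
    (hcm : ∀ i, AEStronglyMeasurable (c i) volume) (hψΛ : ∀ i x j a, |ψ i x j a| ≤ Λ i)
    (hψm : ∀ i j a, AEStronglyMeasurable (fun x => ψ i x j a) volume)
    (hdiv : ∀ i (φ : UnitAddTorus d → ℝ), FunctionSpaces.Torus.IsSmooth φ → ∀ a,
      ∫ x, c i x a * φ x = -∫ x, ∑ j, ψ i x j a * FunctionSpaces.Torus.partialDeriv j φ x)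
    {φ : UnitAddTorus d → ℝ} (hφ : FunctionSpaces.Torus.IsSmooth φ) (a : d) :
    ∫ x, (∑' i, c i x) a * φ x = -∫ x, ∑ j, (∑' i, ψ i x j a) * FunctionSpaces.Torus.partialDeriv j φ x := by
  -- bounded smooth test data
  obtain ⟨C₀, hC₀, hφC⟩ := exists_forall_abs_le_of_isSmooth hφ
  have hdφ : ∀ j, FunctionSpaces.Torus.IsSmooth (FunctionSpaces.Torus.partialDeriv j φ) := fun j => hφ.partialDeriv j
  choose C₁ hC₁ hdφC using fun j => exists_forall_abs_le_of_isSmooth (hdφ j)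
  -- the level terms `F i x := (c i x)_a φ x`
  set F : ι → UnitAddTorus d → ℝ := fun i x => c i x a * φ x with hF
  have hcma : ∀ i, AEStronglyMeasurable (fun x => c i x a) volume := fun i =>
    (PiLp.continuous_apply 2 (fun _ : d => ℝ) a).comp_aestronglyMeasurable (hcm i)
  have hcBa : ∀ i x, ‖c i x a‖ ≤ B i := fun i x => (PiLp.norm_apply_le (c i x) a).trans (hcB i x)
  have hFi : ∀ i, Integrable (F i) volume := fun i =>
    Integrable.bdd_mul (c := B i) hφ.integrable (hcma i) (ae_of_all _ (hcBa i))
  have hFn : ∀ i, ∫ x, ‖F i x‖ ≤ B i * C₀ := by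
    intro i
    have hB0 : 0 ≤ B i := (norm_nonneg _).trans (hcB i 0)
    calc ∫ x, ‖F i x‖ ≤ ∫ x, B i * C₀ ∂(volume : Measure (UnitAddTorus d)) := by
          refine integral_mono (hFi i).norm (integrable_const _) fun x => ?_
          simp only [hF, norm_mul, Real.norm_eq_abs]
          exact mul_le_mul ((Real.norm_eq_abs _).symm.le.trans (hcBa i x)) (hφC x) (abs_nonneg _) hB0
      _ = B i * C₀ := by simp
  have hFs : Summable fun i => ∫ x, ‖F i x‖ :=
    Summable.of_nonneg_of_le (fun i => integral_nonneg fun x => norm_nonneg _) hFn (hB.mul_right C₀)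
  -- the potential terms `G i x := Σ_j (ψ i)_{ja} ∂_j φ x`
  set G : ι → UnitAddTorus d → ℝ := fun i x => ∑ j, ψ i x j a * FunctionSpaces.Torus.partialDeriv j φ x with hG
  have hGi : ∀ i, Integrable (G i) volume := fun i =>
    integrable_finsetSum _ fun j _ => Integrable.bdd_mul (c := Λ i) (hdφ j).integrable (hψm i j a)
      (ae_of_all _ fun x => by simpa only [Real.norm_eq_abs] using hψΛ i x j a)
  have hGn : ∀ i, ∫ x, ‖G i x‖ ≤ Λ i * ∑ j, C₁ j := by
    intro i
    by_cases hd : Nonempty d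
    · obtain ⟨j₀⟩ := hd
      have hΛ0 : 0 ≤ Λ i := (abs_nonneg _).trans (hψΛ i 0 j₀ j₀)
      calc ∫ x, ‖G i x‖ ≤ ∫ x, Λ i * ∑ j, C₁ j ∂(volume : Measure (UnitAddTorus d)) := by
            refine integral_mono (hGi i).norm (integrable_const _) fun x => ?_
            simp only [hG, Real.norm_eq_abs]
            refine (Finset.abs_sum_le_sum_abs _ _).trans ?_
            rw [Finset.mul_sum]
            refine Finset.sum_le_sum fun j _ => ?_
            rw [abs_mul]
            exact mul_le_mul (hψΛ i x j a) (hdφC j x) (abs_nonneg _) hΛ0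
        _ = Λ i * ∑ j, C₁ j := by simp
    · have hempty : IsEmpty d := not_nonempty_iff.1 hd
      simp [hG]
  have hGs : Summable fun i => ∫ x, ‖G i x‖ :=
    Summable.of_nonneg_of_le (fun i => integral_nonneg fun x => norm_nonneg _) hGn (hΛ.mul_right _)
  -- the interchanges
  have hL : ∫ x, (∑' i, c i x) a * φ x = ∑' i, ∫ x, F i x := by
    rw [integral_tsum_of_summable_integral_norm hFi hFs]
    refine integral_congr_ae (ae_of_all _ fun x => ?_)
    simp only [hF]
    rw [tsum_levels_apply hB hcB x a, tsum_mul_right]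
  have hR : ∫ x, ∑ j, (∑' i, ψ i x j a) * FunctionSpaces.Torus.partialDeriv j φ x = ∑' i, ∫ x, G i x := by
    rw [integral_tsum_of_summable_integral_norm hGi hGs]
    refine integral_congr_ae (ae_of_all _ fun x => ?_)
    simp only [hG]
    rw [Summable.tsum_finsetSum fun j _ => ?_]
    · refine Finset.sum_congr rfl fun j _ => ?_
      rw [tsum_mul_right]
    · exact (summable_potential hΛ hψΛ x j a).mul_right _
  rw [hL, hR, ← tsum_neg]
  exact tsum_congr fun i => hdiv i φ hφ a

end Levels

/-! ## §2 The tail form (levels indexed by `ℕ`) -/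

section Tail

variable {c : ℕ → UnitAddTorus d → EuclideanSpace ℝ d} {ψ : ℕ → UnitAddTorus d → d → d → ℝ} {B Λ : ℕ → ℝ}

omit [DecidableEq d] in
/-- The tail of the level series: `Σ' m, c m − Σ_{m<j} c m = Σ' m, c (m+j)`. [cite: HormanderALPDO1, §2.1 Thm. 2.1.8] -/
theorem tsum_levels_sub_sum_range (hB : Summable B) (hcB : ∀ m x, ‖c m x‖ ≤ B m) (j : ℕ) (x : UnitAddTorus d) :
    (∑' m, c m x) - ∑ m ∈ Finset.range j, c m x = ∑' m, c (m + j) x := by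
  rw [← (summable_levels hB hcB x).sum_add_tsum_nat_add j]
  abel

omit [Fintype d] [DecidableEq d] in
/-- The tail of the potential series: `Σ' m, ψ m − Σ_{m<j} ψ m = Σ' m, ψ (m+j)` (componentwise).
[cite: HormanderALPDO1, §2.1 Thm. 2.1.8] -/
theorem tsum_potential_sub_sum_range (hΛ : Summable Λ) (hψΛ : ∀ m x i a, |ψ m x i a| ≤ Λ m) (j : ℕ)
    (x : UnitAddTorus d) (i a : d) :
    (∑' m, ψ m x i a) - ∑ m ∈ Finset.range j, ψ m x i a = ∑' m, ψ (m + j) x i a := by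
  rw [← (summable_potential hΛ hψΛ x i a).sum_add_tsum_nat_add j]
  abel

omit [Fintype d] [DecidableEq d] in
/-- Bound on the tail potential: `|Σ' m, ψ (m+j)| ≤ Σ' m, Λ (m+j)`. [cite: HormanderALPDO1, §2.1 Thm. 2.1.8] -/
theorem abs_tsum_potential_tail_le (hΛ : Summable Λ) (hψΛ : ∀ m x i a, |ψ m x i a| ≤ Λ m) (j : ℕ)
    (x : UnitAddTorus d) (i a : d) : |∑' m, ψ (m + j) x i a| ≤ ∑' m, Λ (m + j) :=
  abs_tsum_potential_le ((summable_nat_add_iff j).2 hΛ) (fun m x i a => hψΛ (m + j) x i a) x i a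

/-- **The tail of the level series is the divergence of the tail potential**: for every `j`,
`∫ (Σ' m, c m − Σ_{m<j} c m)_a φ = −∫ Σ_i (Σ' m, ψ (m+j))_{ia} ∂_i φ`.
[cite: HormanderALPDO1, §3.1 Def. 3.1.1 (continuity of u ↦ ∂ₖu) and §2.1 Thm. 2.1.8] -/
theorem integral_tsum_sub_sum_apply_mul_eq_neg_integral_tsum_potential
    (hB : Summable B) (hΛ : Summable Λ) (hcB : ∀ m x, ‖c m x‖ ≤ B m)
    (hcm : ∀ m, AEStronglyMeasurable (c m) volume) (hψΛ : ∀ m x i a, |ψ m x i a| ≤ Λ m)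
    (hψm : ∀ m i a, AEStronglyMeasurable (fun x => ψ m x i a) volume)
    (hdiv : ∀ m (φ : UnitAddTorus d → ℝ), FunctionSpaces.Torus.IsSmooth φ → ∀ a,
      ∫ x, c m x a * φ x = -∫ x, ∑ i, ψ m x i a * FunctionSpaces.Torus.partialDeriv i φ x)
    (j : ℕ) {φ : UnitAddTorus d → ℝ} (hφ : FunctionSpaces.Torus.IsSmooth φ) (a : d) :
    ∫ x, ((∑' m, c m x) - ∑ m ∈ Finset.range j, c m x) a * φ x =
      -∫ x, ∑ i, (∑' m, ψ (m + j) x i a) * FunctionSpaces.Torus.partialDeriv i φ x := by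
  have hmain := integral_tsum_apply_mul_eq_neg_integral_tsum_potential (c := fun m => c (m + j))
    (ψ := fun m => ψ (m + j)) ((summable_nat_add_iff j).2 hB) ((summable_nat_add_iff j).2 hΛ)
    (fun m x => hcB (m + j) x) (fun m => hcm (m + j)) (fun m x i a => hψΛ (m + j) x i a)
    (fun m i a => hψm (m + j) i a) (fun m φ hφ a => hdiv (m + j) φ hφ a) hφ a
  rw [← hmain]
  refine integral_congr_ae (ae_of_all _ fun x => ?_)
  simp only
  rw [tsum_levels_sub_sum_range hB hcB j x]

end Tail

/-! ## §3 Time-dependent lift: the stream hypotheses of `PassiveVectorTensorStreamStability` from levels -/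

section TimeDependent

variable {ι : Type*} {T : ℝ} {b b' : ℝ → UnitAddTorus d → EuclideanSpace ℝ d}
  {c : ι → ℝ → UnitAddTorus d → EuclideanSpace ℝ d} {ψ : ι → ℝ → UnitAddTorus d → d → d → ℝ} {B Λ : ι → ℝ}

omit [Fintype d] [DecidableEq d] in
/-- Antisymmetry of the summed time-dependent potential (hypothesis `hanti` of
`ae_integral_norm_sq_sub_le_of_stream`, for ALL times). [cite: HormanderALPDO1, §3.1 Def. 3.1.1] -/
theorem tsum_potential_antisymm_time (hanti : ∀ i s x j a, ψ i s x j a = -ψ i s x a j) (s : ℝ)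
    (x : UnitAddTorus d) (j a : d) : (∑' i, ψ i s x j a) = -∑' i, ψ i s x a j :=
  tsum_potential_antisymm (ψ := fun i => ψ i s) (fun i x j a => hanti i s x j a) x j a

/-- **The stream hypotheses from levelwise data.** If on `(0,T)` the carrier difference is a sum of
levels, `b s x − b' s x = Σ' i, c i s x`, every level being the weak divergence of a potential
`ψ i s` with `‖c i s x‖ ≤ B i`, `|ψ i s x j a| ≤ Λ i`, `Σ B`, `Σ Λ < ∞`, then the summed potential
`Ψ s x j a := Σ' i, ψ i s x j a` satisfies the three a.e.-in-time hypotheses `hψΛ` (with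
`Λ := Σ' i, Λ i`), `hψm`, `hdivψ` of `IsWeakTensorPassiveVectorOn.ae_integral_norm_sq_sub_le_of_stream`
(its fourth, `hanti`, is `tsum_potential_antisymm_time`).
[cite: HormanderALPDO1, §3.1 Def. 3.1.1 and §2.1 Thm. 2.1.8] -/
theorem stream_of_levels [Countable ι] (hB : Summable B) (hΛ : Summable Λ)
    (hsub : ∀ s ∈ Ioo 0 T, ∀ x, b s x - b' s x = ∑' i, c i s x)
    (hcB : ∀ i, ∀ s ∈ Ioo 0 T, ∀ x, ‖c i s x‖ ≤ B i)
    (hcm : ∀ i, ∀ s ∈ Ioo 0 T, AEStronglyMeasurable (c i s) volume)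
    (hψΛ : ∀ i, ∀ s ∈ Ioo 0 T, ∀ x j a, |ψ i s x j a| ≤ Λ i)
    (hψm : ∀ i, ∀ s ∈ Ioo 0 T, ∀ j a, AEStronglyMeasurable (fun x => ψ i s x j a) volume)
    (hdiv : ∀ i, ∀ s ∈ Ioo 0 T, ∀ φ : UnitAddTorus d → ℝ, FunctionSpaces.Torus.IsSmooth φ → ∀ a,
      ∫ x, c i s x a * φ x = -∫ x, ∑ j, ψ i s x j a * FunctionSpaces.Torus.partialDeriv j φ x) :
    (∀ᵐ s ∂(volume.restrict (Ioo 0 T)), ∀ᵐ x ∂volume, ∀ j a, |∑' i, ψ i s x j a| ≤ ∑' i, Λ i) ∧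
    (∀ᵐ s ∂(volume.restrict (Ioo 0 T)), ∀ j a, AEStronglyMeasurable (fun x => ∑' i, ψ i s x j a) volume) ∧
    (∀ᵐ s ∂(volume.restrict (Ioo 0 T)), ∀ φ : UnitAddTorus d → ℝ, FunctionSpaces.Torus.IsSmooth φ → ∀ a,
      ∫ x, (b s x a - b' s x a) * φ x =
        -∫ x, ∑ j, (∑' i, ψ i s x j a) * FunctionSpaces.Torus.partialDeriv j φ x) := by
  have hmem : ∀ᵐ s ∂(volume.restrict (Ioo 0 T)), s ∈ Ioo (0 : ℝ) T := ae_restrict_mem measurableSet_Ioo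
  refine ⟨?_, ?_, ?_⟩
  · filter_upwards [hmem] with s hs
    exact ae_of_all _ fun x j a =>
      abs_tsum_potential_le (ψ := fun i => ψ i s) hΛ (fun i x j a => hψΛ i s hs x j a) x j a
  · filter_upwards [hmem] with s hs j a
    exact aestronglyMeasurable_tsum_potential (ψ := fun i => ψ i s) hΛ (fun i x j a => hψΛ i s hs x j a)
      (fun i j a => hψm i s hs j a) j a
  · filter_upwards [hmem] with s hs φ hφ a
    have hmain := integral_tsum_apply_mul_eq_neg_integral_tsum_potential (c := fun i => c i s)
      (ψ := fun i => ψ i s) hB hΛ (fun i x => hcB i s hs x) (fun i => hcm i s hs)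
      (fun i x j a => hψΛ i s hs x j a) (fun i j a => hψm i s hs j a) (fun i φ hφ a => hdiv i s hs φ hφ a) hφ a
    rw [← hmain]
    refine integral_congr_ae (ae_of_all _ fun x => ?_)
    simp only
    rw [← PiLp.sub_apply, hsub s hs x]

end TimeDependent

section TimeDependentTail

variable {T : ℝ} {b b' : ℝ → UnitAddTorus d → EuclideanSpace ℝ d}
  {c : ℕ → ℝ → UnitAddTorus d → EuclideanSpace ℝ d} {ψ : ℕ → ℝ → UnitAddTorus d → d → d → ℝ} {B Λ : ℕ → ℝ}

/-- **The stream hypotheses for an infinite TAIL.** If `b = Σ' m, c m` (all levels, pointwise on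
`(0,T)`) and `b' = Σ_{m<j} c m` (its `j`-th partial sum), every level being the weak divergence of a
potential `ψ m s` with `‖c m‖ ≤ B m`, `|ψ m| ≤ Λ m`, `Σ B`, `Σ Λ < ∞`, then the TAIL potential
`Ψ s x i a := Σ' m, ψ (m+j) s x i a` satisfies the a.e.-in-time hypotheses `hψΛ` (with
`Λ := Σ' m, Λ (m+j)`), `hψm`, `hdivψ` of `IsWeakTensorPassiveVectorOn.ae_integral_norm_sq_sub_le_of_stream`
for the pair `(b, b')` (antisymmetry: `tsum_potential_antisymm_time` for the shifted family). This is
the shape of the K1L infinite-tail step (carrier `Σ' m, b (m+1)` versus `partialSum j`).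
[cite: HormanderALPDO1, §3.1 Def. 3.1.1 and §2.1 Thm. 2.1.8] -/
theorem stream_of_levels_tail (hB : Summable B) (hΛ : Summable Λ) (j : ℕ)
    (hb : ∀ s ∈ Ioo 0 T, ∀ x, b s x = ∑' m, c m s x)
    (hb' : ∀ s ∈ Ioo 0 T, ∀ x, b' s x = ∑ m ∈ Finset.range j, c m s x)
    (hcB : ∀ m, ∀ s ∈ Ioo 0 T, ∀ x, ‖c m s x‖ ≤ B m)
    (hcm : ∀ m, ∀ s ∈ Ioo 0 T, AEStronglyMeasurable (c m s) volume)
    (hψΛ : ∀ m, ∀ s ∈ Ioo 0 T, ∀ x i a, |ψ m s x i a| ≤ Λ m)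
    (hψm : ∀ m, ∀ s ∈ Ioo 0 T, ∀ i a, AEStronglyMeasurable (fun x => ψ m s x i a) volume)
    (hdiv : ∀ m, ∀ s ∈ Ioo 0 T, ∀ φ : UnitAddTorus d → ℝ, FunctionSpaces.Torus.IsSmooth φ → ∀ a,
      ∫ x, c m s x a * φ x = -∫ x, ∑ i, ψ m s x i a * FunctionSpaces.Torus.partialDeriv i φ x) :
    (∀ᵐ s ∂(volume.restrict (Ioo 0 T)), ∀ᵐ x ∂volume, ∀ i a, |∑' m, ψ (m + j) s x i a| ≤ ∑' m, Λ (m + j)) ∧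
    (∀ᵐ s ∂(volume.restrict (Ioo 0 T)), ∀ i a, AEStronglyMeasurable (fun x => ∑' m, ψ (m + j) s x i a) volume) ∧
    (∀ᵐ s ∂(volume.restrict (Ioo 0 T)), ∀ φ : UnitAddTorus d → ℝ, FunctionSpaces.Torus.IsSmooth φ → ∀ a,
      ∫ x, (b s x a - b' s x a) * φ x =
        -∫ x, ∑ i, (∑' m, ψ (m + j) s x i a) * FunctionSpaces.Torus.partialDeriv i φ x) := by
  refine stream_of_levels (c := fun m => c (m + j)) (ψ := fun m => ψ (m + j))
    ((summable_nat_add_iff j).2 hB) ((summable_nat_add_iff j).2 hΛ) (fun s hs x => ?_)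
    (fun m s hs x => hcB (m + j) s hs x) (fun m s hs => hcm (m + j) s hs)
    (fun m s hs x i a => hψΛ (m + j) s hs x i a) (fun m s hs i a => hψm (m + j) s hs i a)
    (fun m s hs φ hφ a => hdiv (m + j) s hs φ hφ a)
  rw [hb s hs x, hb' s hs x]
  exact tsum_levels_sub_sum_range (c := fun m => c m s) hB (fun m x => hcB m s hs x) j x

end TimeDependentTail

/-! ## §4 The energy-class stability with levelwise hypotheses -/

section Stability

namespace IsWeakTensorPassiveVectorOn

variable {ι : Type*} [Countable ι] {T : ℝ} {𝔸 : Visc4 d}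
  {b b' w u : ℝ → UnitAddTorus d → EuclideanSpace ℝ d} {w₀ : UnitAddTorus d → EuclideanSpace ℝ d}
  {c : ι → ℝ → UnitAddTorus d → EuclideanSpace ℝ d} {ψ : ι → ℝ → UnitAddTorus d → d → d → ℝ} {B Λ : ι → ℝ}

/-- **Energy-class stability under a SERIES of stream-potential perturbations of the carrier**
(`A = 0`): the hypotheses of `ae_integral_norm_sq_sub_le_of_stream` with the stream data supplied
LEVELWISE (`b − b' = Σ' i, c i`, `c i = ∇·ψ i` weakly, `‖c i‖ ≤ B i`, `|ψ i| ≤ Λ i`, `0 ≤ Λ i`,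
`Σ B`, `Σ Λ < ∞`) give, for a.e. `t ∈ (0,T)`,
`∫ ‖w(t) − u(t)‖² ≤ (d² (Σ'Λ)² / (2 lo)) ∫₀ᵗ ‖∇u‖₂²`.
[cite: RobinsonRodrigoSadowski2016, §4.2 (4.20)] [cite: DiPernaLions1989, §II.1 Thm. II.1]
[cite: HormanderALPDO1, §3.1 Def. 3.1.1] -/
theorem ae_integral_norm_sq_sub_le_of_levels (h₁ : IsWeakTensorPassiveVectorOn 0 T 𝔸 b w₀ w)
    (h₂ : IsWeakTensorPassiveVectorOn 0 T 𝔸 b' w₀ u) {lo hi : ℝ} (h𝔸 : NearIso 𝔸 lo hi) (hlo : 0 < lo)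
    (hw₀ : MemLp w₀ 2 volume) (hdiv₀ : FunctionSpaces.Torus.IsWeaklyDivFree w₀)
    (hb' : MemLp (FunctionSpaces.Torus.stLift b') ∞ (volume.restrict (Ioo 0 T ×ˢ univ)))
    {M M' : ℝ} (hM : 0 ≤ M) (hM' : 0 ≤ M')
    (hbM : ∀ᵐ s ∂(volume.restrict (Ioo 0 T)), ∀ᵐ x ∂volume, ‖b s x‖ ≤ M)
    (hbM' : ∀ᵐ s ∂(volume.restrict (Ioo 0 T)), ∀ᵐ x ∂volume, ‖b' s x‖ ≤ M')
    (hB : Summable B) (hΛ : Summable Λ) (hΛ0 : ∀ i, 0 ≤ Λ i)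
    (hsub : ∀ s ∈ Ioo 0 T, ∀ x, b s x - b' s x = ∑' i, c i s x)
    (hcB : ∀ i, ∀ s ∈ Ioo 0 T, ∀ x, ‖c i s x‖ ≤ B i)
    (hcm : ∀ i, ∀ s ∈ Ioo 0 T, AEStronglyMeasurable (c i s) volume)
    (hanti : ∀ i s x j a, ψ i s x j a = -ψ i s x a j)
    (hψΛ : ∀ i, ∀ s ∈ Ioo 0 T, ∀ x j a, |ψ i s x j a| ≤ Λ i)
    (hψm : ∀ i, ∀ s ∈ Ioo 0 T, ∀ j a, AEStronglyMeasurable (fun x => ψ i s x j a) volume)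
    (hdiv : ∀ i, ∀ s ∈ Ioo 0 T, ∀ φ : UnitAddTorus d → ℝ, FunctionSpaces.Torus.IsSmooth φ → ∀ a,
      ∫ x, c i s x a * φ x = -∫ x, ∑ j, ψ i s x j a * FunctionSpaces.Torus.partialDeriv j φ x) :
    ∀ᵐ t ∂(volume.restrict (Ioo 0 T)),
      ∫ x, ‖w t x - u t x‖ ^ 2 ≤
        (Fintype.card d : ℝ) ^ 2 * (∑' i, Λ i) ^ 2 / (2 * lo) *
          ∫ s in Ioc 0 t, (FunctionSpaces.Torus.eGradNormSq (u s)).toReal := by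
  obtain ⟨hΨΛ, hΨm, hΨdiv⟩ := stream_of_levels hB hΛ hsub hcB hcm hψΛ hψm hdiv
  exact ae_integral_norm_sq_sub_le_of_stream h₁ h₂ h𝔸 hlo hw₀ hdiv₀ hb' hM hM' hbM hbM'
    (tsum_potential_antisymm_time hanti) (tsum_nonneg hΛ0) hΨΛ hΨm hΨdiv

/-- The same against the datum energy: `∫ ‖w(t) − u(t)‖² ≤ (d² (Σ'Λ)² / (4 lo²)) ∫ ‖w₀‖²`.
[cite: RobinsonRodrigoSadowski2016, §4.2 (4.20)] [cite: DiPernaLions1989, §II.1 Thm. II.1]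
[cite: HormanderALPDO1, §3.1 Def. 3.1.1] -/
theorem ae_integral_norm_sq_sub_le_of_levels_datum (h₁ : IsWeakTensorPassiveVectorOn 0 T 𝔸 b w₀ w)
    (h₂ : IsWeakTensorPassiveVectorOn 0 T 𝔸 b' w₀ u) {lo hi : ℝ} (h𝔸 : NearIso 𝔸 lo hi) (hlo : 0 < lo)
    (hw₀ : MemLp w₀ 2 volume) (hdiv₀ : FunctionSpaces.Torus.IsWeaklyDivFree w₀)
    (hb' : MemLp (FunctionSpaces.Torus.stLift b') ∞ (volume.restrict (Ioo 0 T ×ˢ univ)))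
    {M M' : ℝ} (hM : 0 ≤ M) (hM' : 0 ≤ M')
    (hbM : ∀ᵐ s ∂(volume.restrict (Ioo 0 T)), ∀ᵐ x ∂volume, ‖b s x‖ ≤ M)
    (hbM' : ∀ᵐ s ∂(volume.restrict (Ioo 0 T)), ∀ᵐ x ∂volume, ‖b' s x‖ ≤ M')
    (hB : Summable B) (hΛ : Summable Λ) (hΛ0 : ∀ i, 0 ≤ Λ i)
    (hsub : ∀ s ∈ Ioo 0 T, ∀ x, b s x - b' s x = ∑' i, c i s x)
    (hcB : ∀ i, ∀ s ∈ Ioo 0 T, ∀ x, ‖c i s x‖ ≤ B i)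
    (hcm : ∀ i, ∀ s ∈ Ioo 0 T, AEStronglyMeasurable (c i s) volume)
    (hanti : ∀ i s x j a, ψ i s x j a = -ψ i s x a j)
    (hψΛ : ∀ i, ∀ s ∈ Ioo 0 T, ∀ x j a, |ψ i s x j a| ≤ Λ i)
    (hψm : ∀ i, ∀ s ∈ Ioo 0 T, ∀ j a, AEStronglyMeasurable (fun x => ψ i s x j a) volume)
    (hdiv : ∀ i, ∀ s ∈ Ioo 0 T, ∀ φ : UnitAddTorus d → ℝ, FunctionSpaces.Torus.IsSmooth φ → ∀ a,
      ∫ x, c i s x a * φ x = -∫ x, ∑ j, ψ i s x j a * FunctionSpaces.Torus.partialDeriv j φ x) :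
    ∀ᵐ t ∂(volume.restrict (Ioo 0 T)),
      ∫ x, ‖w t x - u t x‖ ^ 2 ≤ (Fintype.card d : ℝ) ^ 2 * (∑' i, Λ i) ^ 2 / (4 * lo ^ 2) * ∫ x, ‖w₀ x‖ ^ 2 := by
  obtain ⟨hΨΛ, hΨm, hΨdiv⟩ := stream_of_levels hB hΛ hsub hcB hcm hψΛ hψm hdiv
  exact ae_integral_norm_sq_sub_le_of_stream_datum h₁ h₂ h𝔸 hlo hw₀ hdiv₀ hb' hM hM' hbM hbM'
    (tsum_potential_antisymm_time hanti) (tsum_nonneg hΛ0) hΨΛ hΨm hΨdiv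

/-- **Drop form with levelwise hypotheses** (`A = 0`): for a.e. `t ∈ (0,T)`,
`∫ ‖w(t)‖² ≤ ∫ ‖u(t)‖² + (2η + η²) ∫ ‖w₀‖²`, `η = d (Σ' i, Λ i) / (2 lo)` — in the K1L tail step
`drop w₀ u t ≤ drop w₀ w t + (2η + η²)‖w₀‖²` with `Σ' Λ = Σ_{m>j} ‖ψ_m‖_∞` the tail potential size.
[cite: RobinsonRodrigoSadowski2016, §4.2 (4.20)] [cite: DiPernaLions1989, §II.1 Thm. II.1]
[cite: HormanderALPDO1, §3.1 Def. 3.1.1] -/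
theorem ae_integral_norm_sq_le_add_of_levels (h₁ : IsWeakTensorPassiveVectorOn 0 T 𝔸 b w₀ w)
    (h₂ : IsWeakTensorPassiveVectorOn 0 T 𝔸 b' w₀ u) {lo hi : ℝ} (h𝔸 : NearIso 𝔸 lo hi) (hlo : 0 < lo)
    (hw₀ : MemLp w₀ 2 volume) (hdiv₀ : FunctionSpaces.Torus.IsWeaklyDivFree w₀)
    (hb' : MemLp (FunctionSpaces.Torus.stLift b') ∞ (volume.restrict (Ioo 0 T ×ˢ univ)))
    {M M' : ℝ} (hM : 0 ≤ M) (hM' : 0 ≤ M')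
    (hbM : ∀ᵐ s ∂(volume.restrict (Ioo 0 T)), ∀ᵐ x ∂volume, ‖b s x‖ ≤ M)
    (hbM' : ∀ᵐ s ∂(volume.restrict (Ioo 0 T)), ∀ᵐ x ∂volume, ‖b' s x‖ ≤ M')
    (hB : Summable B) (hΛ : Summable Λ) (hΛ0 : ∀ i, 0 ≤ Λ i)
    (hsub : ∀ s ∈ Ioo 0 T, ∀ x, b s x - b' s x = ∑' i, c i s x)
    (hcB : ∀ i, ∀ s ∈ Ioo 0 T, ∀ x, ‖c i s x‖ ≤ B i)
    (hcm : ∀ i, ∀ s ∈ Ioo 0 T, AEStronglyMeasurable (c i s) volume)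
    (hanti : ∀ i s x j a, ψ i s x j a = -ψ i s x a j)
    (hψΛ : ∀ i, ∀ s ∈ Ioo 0 T, ∀ x j a, |ψ i s x j a| ≤ Λ i)
    (hψm : ∀ i, ∀ s ∈ Ioo 0 T, ∀ j a, AEStronglyMeasurable (fun x => ψ i s x j a) volume)
    (hdiv : ∀ i, ∀ s ∈ Ioo 0 T, ∀ φ : UnitAddTorus d → ℝ, FunctionSpaces.Torus.IsSmooth φ → ∀ a,
      ∫ x, c i s x a * φ x = -∫ x, ∑ j, ψ i s x j a * FunctionSpaces.Torus.partialDeriv j φ x) :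
    ∀ᵐ t ∂(volume.restrict (Ioo 0 T)),
      ∫ x, ‖w t x‖ ^ 2 ≤ (∫ x, ‖u t x‖ ^ 2) +
        (2 * Real.sqrt ((Fintype.card d : ℝ) ^ 2 * (∑' i, Λ i) ^ 2 / (4 * lo ^ 2)) +
          (Fintype.card d : ℝ) ^ 2 * (∑' i, Λ i) ^ 2 / (4 * lo ^ 2)) * ∫ x, ‖w₀ x‖ ^ 2 := by
  obtain ⟨hΨΛ, hΨm, hΨdiv⟩ := stream_of_levels hB hΛ hsub hcB hcm hψΛ hψm hdiv
  exact ae_integral_norm_sq_le_add_of_stream h₁ h₂ h𝔸 hlo hw₀ hdiv₀ hb' hM hM' hbM hbM'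
    (tsum_potential_antisymm_time hanti) (tsum_nonneg hΛ0) hΨΛ hΨm hΨdiv

end IsWeakTensorPassiveVectorOn

end Stability

/-! ## §5 The smallness coefficient -/

section Coefficient

/-- `2√(D²Λ²/(4lo²)) + D²Λ²/(4lo²) = 2η + η²` with `η = DΛ/(2lo)` (`D, Λ ≥ 0`, `lo > 0`): the arithmetic of the
constant in the drop form of the energy-class stability estimate.
[cite: RobinsonRodrigoSadowski2016, §4.2 (4.20) (stability constant, arithmetic only)] -/
theorem stream_coeff_eq {D Λ lo : ℝ} (hD : 0 ≤ D) (hΛ : 0 ≤ Λ) (hlo : 0 < lo) :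
    2 * Real.sqrt (D ^ 2 * Λ ^ 2 / (4 * lo ^ 2)) + D ^ 2 * Λ ^ 2 / (4 * lo ^ 2) =
      2 * (D * Λ / (2 * lo)) + (D * Λ / (2 * lo)) ^ 2 := by
  have h : D ^ 2 * Λ ^ 2 / (4 * lo ^ 2) = (D * Λ / (2 * lo)) ^ 2 := by
    field_simp
    ring
  rw [h, Real.sqrt_sq (by positivity)]

/-- If the ratio `η = DΛ/(2lo)` is at most `r ≤ 1`, the coefficient is at most `3r`.
[cite: RobinsonRodrigoSadowski2016, §4.2 (4.20) (stability constant, arithmetic only)] -/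
theorem stream_coeff_le_of_ratio_le {D Λ lo r : ℝ} (hD : 0 ≤ D) (hΛ : 0 ≤ Λ) (hlo : 0 < lo)
    (hr : D * Λ / (2 * lo) ≤ r) (hr1 : r ≤ 1) :
    2 * Real.sqrt (D ^ 2 * Λ ^ 2 / (4 * lo ^ 2)) + D ^ 2 * Λ ^ 2 / (4 * lo ^ 2) ≤ 3 * r := by
  rw [stream_coeff_eq hD hΛ hlo]
  have h0 : 0 ≤ D * Λ / (2 * lo) := by positivity
  nlinarith [h0, hr, hr1]

/-- `ε`-form: the coefficient is `≤ ε` as soon as `DΛ/(2lo) ≤ min 1 (ε/3)`.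
[cite: RobinsonRodrigoSadowski2016, §4.2 (4.20) (stability constant, arithmetic only)] -/
theorem stream_coeff_le_of_ratio_le_min {D Λ lo ε : ℝ} (hD : 0 ≤ D) (hΛ : 0 ≤ Λ) (hlo : 0 < lo)
    (hr : D * Λ / (2 * lo) ≤ min 1 (ε / 3)) :
    2 * Real.sqrt (D ^ 2 * Λ ^ 2 / (4 * lo ^ 2)) + D ^ 2 * Λ ^ 2 / (4 * lo ^ 2) ≤ ε := by
  have h := stream_coeff_le_of_ratio_le hD hΛ hlo hr (min_le_left _ _)
  have h3 : 3 * min 1 (ε / 3) ≤ ε := by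
    have := min_le_right (1 : ℝ) (ε / 3)
    linarith
  exact h.trans h3

end Coefficient

end Torus

end Literature.Analysis.FluidPDE

end
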